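import Literature.Geometry.Lorentzian.MassCapacityPotential
import Literature.Geometry.Lorentzian.MassCapacityIsometry
import Literature.Geometry.Lorentzian.ExteriorRegionSchwarzschildEnd
import Mathlib.Topology.Algebra.Indicator
import HarnessLib

/-!
# Bray's (92)–(93): on a reflection-symmetric two-ended manifold the potential of the chosen
# end is `½` on the fixed horizon, and the capacity of that horizon is `4 c_φ`

Companion of `MassCapacityPotential.lean` and `MassCapacityIsometry.lean`. Bray,
J. Differential Geom. 59 (2001), §6, proves Thm. 9 (`m ≥ ½ ℰ(Σ, g)`) by reflecting the outside
`(M³_Σ, g)` of the horizon through `Σ`: on the doubled manifold `(M̄³_Σ, ḡ)`, with two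
asymptotically flat ends exchanged by the reflection, *"define `φ(x)` on `(M̄³_Σ, ḡ)` using
equation (81)* [harmonic, `→ 1` in the chosen end, `→ 0` in the other] *and `ϕ(x)` on `(M³_Σ, g)`
using equation (86)* [the capacity potential of `Σ`]. *It follows from symmetry that `φ(x) = ½` on
`Σ`, so that `φ(x) = ½(ϕ(x) + 1)` (92) on `(M³_Σ, g)`. Then `ℰ(ḡ) = ½ ℰ(Σ, g)` (93), so that
theorem 9 follows from theorem 8."* This file proves the content of (92)–(93) for any smooth
connected Riemannian `3`-manifold `(X, h)` **with exactly two ends** `e₁`, `e₂` (the complement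
of the union of two far regions is compact) carrying an **isometry `ι` exchanging the ends**
(hypotheses `hiso`, `h₂₁`, `h₁₂`; e.g. the reflection of a smoothed double), in terms of the
potential `φ` of (81) — whose existence is NOT proved here — and of its monopole coefficient `c`
at `e₁` (`φ ∘ Φ = 1 − c/r + O₁(r⁻²)`, so that `ℰ(ḡ) = 2c` by (82) and Thm. 8 reads `m̄ ≥ 2c`):

* `PseudoRiemannianMetric.dalembertian_congr_metric`, `InitialDataSet.dalembertian_comp_isometry`
  — isometries commute with the Laplace–Beltrami operator (`dalembertian_comap` of
  `DalembertianNaturality.lean` and `InitialDataSet.metric_eq_comap_of_inner_eq`);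
* `nonneg_of_dalembertian_le_twoEnds`, `nonneg_of_dalembertian_nonpos_twoEnds`,
  `eq_of_dalembertian_eq_twoEnds` — the minimum principle and uniqueness for `Δ_h u ≤ c u` on a
  manifold with exactly two ends (E. Hopf, `HopfPositivity.lean`; the uniqueness of (81));
* `harmonic_add_comp_isometry_eq_one` (`φ + φ ∘ ι = 1`), `harmonic_eq_half_of_isometry_fixed`
  (**`φ = ½` on the fixed set of `ι`**, Bray's (92));
* for an exterior region `V` of `e₁` whose boundary is fixed by `ι`:
  `isCapacityTestFn_indicator_two_mul_sub_one` (**`ϕ = 𝟙_V (2φ − 1)` is a capacity test function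
  of `Σ = ∂V`**), `dalembertian_indicator_eq_zero` (harmonic on `V`), `gradNorm_indicator_eq`,
  `setLIntegral_gradNorm_sq_indicator_eq` (`∫_V |∇ϕ|² = 4 ∫_V |∇φ|²`),
  `isBigO_fderiv_endValue_indicator` (`ϕ ∘ Φ = 1 − 2c/r + O₁(r⁻²)`);
* `horizonCapacity_eq_of_harmonic_symmetric` — **`ℰ(Σ, h) = horizonCapacity h e₁ V = 4c`**, i.e.
  `½ ℰ(Σ, g) = 2c = ℰ(ḡ)`, Bray's (93) (via `horizonCapacity_eq_ofReal_of_harmonic_of_expansion'`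
  of `MassCapacityPotential.lean`); `horizonCapacity_toReal_div_two_eq_of_harmonic_symmetric` —
  the same as `(horizonCapacity).toReal / 2 = 2c`, `c ≥ 0`.

Everything is proved; no definitions and no named facts are introduced. What is not addressed:
the construction of the double and of its smoothing (94)–(103), the existence and the expansion
of the potential `φ` of (81) (elliptic theory), and Thm. 8 itself (positive mass theorem).

## References

* H. L. Bray, *Proof of the Riemannian Penrose inequality using the positive mass theorem*,
  J. Differential Geom. 59 (2001) 177–267 (arXiv:math/9911173), §6: (81)–(82), Def. 17 with
  (86)–(87), proof of Thm. 9, (92)–(94). [BrayRPI2001]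
* J. López-Gómez, *Linear Second Order Elliptic Operators*, World Scientific 2013, Thm. 1.2
  (E. Hopf's minimum principle). [LopezGomez2012]
* B. O'Neill, *Semi-Riemannian Geometry with Applications to Relativity*, Academic Press 1983,
  Ch. 3, Prop. 3.59 and pp. 90–91 (naturality under isometries). [ONeill1983]
-/

noncomputable section

open Bundle Set Function Manifold TopologicalSpace Filter MeasureTheory Bornology Asymptotics
open scoped ContDiff Topology Manifold Real

namespace Literature.Geometry.Lorentzian

open PseudoRiemannianMetric

/-! ### The Laplace–Beltrami operator under an isometry -/

section Isometry

variable {X : Type} [TopologicalSpace X] [ChartedSpace E3 X] [IsManifold (𝓡 3) ∞ X]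

/-- Equal metrics have equal Laplace–Beltrami operators, whatever the (propositional)
Levi-Civita instances. [folklore] -/
theorem PseudoRiemannianMetric.dalembertian_congr_metric
    {g₁ g₂ : PseudoRiemannianMetric (𝓡 3) ∞ E3 (TangentSpace (𝓡 3) : X → Type _)}
    [i₁ : g₁.HasLeviCivita] [i₂ : g₂.HasLeviCivita] (hg : g₁ = g₂) (f : X → ℝ) (x : X) :
    g₁.dalembertian f x = g₂.dalembertian f x := by
  subst hg
  rfl

variable (D : InitialDataSet (𝓡 3) X) [D.metric.HasLeviCivita]

/-- **Isometries commute with the Laplace–Beltrami operator**: for a self-isometry `ι` of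
`(X, h)` (`h(dι v, dι w) = h(v, w)`) and `f` of class `C²` at `ι u`,
`Δ_h (f ∘ ι)(u) = (Δ_h f)(ι u)` — the metric is its own pullback `ι^* h`
(`InitialDataSet.metric_eq_comap_of_inner_eq`) and `Δ_{ι^*h}(f ∘ ι) = (Δ_h f) ∘ ι`
(`dalembertian_comap`, O'Neill 1983, Ch. 3, Prop. 3.59 and pp. 90–91).
[cite: ONeill1983, Ch. 3, Prop. 3.59] -/
theorem InitialDataSet.dalembertian_comp_isometry (ι : Diffeomorph (𝓡 3) (𝓡 3) X X ∞)
    (hiso : ∀ (x : X) (v w : TangentSpace (𝓡 3) x),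
      D.h.inner (ι x) (mfderiv (𝓡 3) (𝓡 3) ι x v) (mfderiv (𝓡 3) (𝓡 3) ι x w) = D.h.inner x v w)
    {f : X → ℝ} {u : X} (hf : ContMDiffAt (𝓡 3) 𝓘(ℝ, ℝ) 2 f (ι u)) :
    D.metric.dalembertian (f ∘ ι) u = D.metric.dalembertian f (ι u) := by
  have hD := InitialDataSet.metric_eq_comap_of_inner_eq D D ι hiso
  haveI := (D.metric.comap contMDiff_pullbackBilin_holds ι ι.contMDiff
    (Diffeomorph.mfderiv_injective ι) rfl).hasLeviCivita
  rw [PseudoRiemannianMetric.dalembertian_congr_metric hD (f ∘ ι) u]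
  exact D.metric.dalembertian_comap contMDiff_pullbackBilin_holds ι.contMDiff
    (Diffeomorph.mfderiv_injective ι) rfl hf

end Isometry

/-! ### The minimum principle and uniqueness on a manifold with exactly two ends -/

section TwoEnds

variable {X : Type} [TopologicalSpace X] [ChartedSpace E3 X] [IsManifold (𝓡 3) ∞ X]
  (h : ContMDiffRiemannianMetric (𝓡 3) ∞ E3 (TangentSpace (𝓡 3) : X → Type _))
  [(ofRiemannian h).HasLeviCivita] {e₁ e₂ : AFEnd X}

/-- **Minimum principle on a manifold with exactly two ends.** Let `X` be connected and
"compact modulo the two ends `e₁`, `e₂`" (the complement of the union of any two far regions is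
compact), `c ≥ 0` continuous, and `u` of class `C²` with `Δ_h u ≤ c u` (e.g. `Δ_h u ≤ 0`). If
`liminf u ≥ 0` at infinity in both ends, then `u ≥ 0`: a negative value would give a negative
global minimum attained on the compact core, so that `u` would be a negative constant by
E. Hopf's minimum principle (`dalembertian_supersolution_eq_of_exists_eq`), impossible far out.
This is the maximum principle behind the uniqueness of the potential (81)/(86) on Bray's doubled
manifolds (§6, proofs of Thms. 8–9). [cite: LopezGomez2012, Thm. 1.2] [cite: BrayRPI2001, §6 (81)] -/
theorem nonneg_of_dalembertian_le_twoEnds [ConnectedSpace X]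
    (htwo : ∀ R₁ R₂, IsCompact (e₁.far R₁ ∪ e₂.far R₂)ᶜ) {u c : X → ℝ}
    (hu2 : ContMDiff (𝓡 3) 𝓘(ℝ, ℝ) 2 u) (hc : Continuous c) (hc0 : ∀ x, 0 ≤ c x)
    (hΔ : ∀ x, (ofRiemannian h).dalembertian u x ≤ c x * u x)
    (hinf₁ : ∀ ε : ℝ, 0 < ε → ∃ R, ∀ x ∈ e₁.far R, -ε < u x)
    (hinf₂ : ∀ ε : ℝ, 0 < ε → ∃ R, ∀ x ∈ e₂.far R, -ε < u x) :
    ∀ x, 0 ≤ u x := by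
  by_contra! hneg
  obtain ⟨x₁, hx₁⟩ := hneg
  have huc : Continuous u := hu2.continuous
  set ε : ℝ := -u x₁ / 2 with hε_def
  have hε : 0 < ε := by rw [hε_def]; linarith
  obtain ⟨R₁, hR₁⟩ := hinf₁ ε hε
  obtain ⟨R₂, hR₂⟩ := hinf₂ ε hε
  have hK : IsCompact (e₁.far R₁ ∪ e₂.far R₂)ᶜ := htwo R₁ R₂
  have hx₁K : x₁ ∈ (e₁.far R₁ ∪ e₂.far R₂)ᶜ := by
    rintro (hx | hx)
    · have := hR₁ x₁ hx; rw [hε_def] at this; linarith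
    · have := hR₂ x₁ hx; rw [hε_def] at this; linarith
  obtain ⟨x₀, -, hmin⟩ := hK.exists_isMinOn ⟨x₁, hx₁K⟩ huc.continuousOn
  have hm₁ : u x₀ ≤ u x₁ := hmin hx₁K
  have hm0 : u x₀ < 0 := hm₁.trans_lt hx₁
  have hlow : ∀ x, u x₀ ≤ u x := fun x ↦ by
    by_cases hx : x ∈ e₁.far R₁ ∪ e₂.far R₂
    · rcases hx with hx | hx
      · have := hR₁ x hx; rw [hε_def] at this; linarith
      · have := hR₂ x hx; rw [hε_def] at this; linarith
    · exact hmin hx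
  have hall := (ofRiemannian h).dalembertian_supersolution_eq_of_exists_eq
    (isRiemannian_ofRiemannian h) hc hc0 hu2 hΔ hm0.le hlow (x₀ := x₀) rfl
  obtain ⟨x₂, hx₂⟩ := AFEnd.far_nonempty e₁ R₁
  have h1 := hall x₂
  have h2 := hR₁ x₂ hx₂
  rw [hε_def] at h2
  linarith

/-- **Minimum principle for superharmonic functions on a manifold with exactly two ends**
(`c = 0`). [cite: LopezGomez2012, Thm. 1.2] [cite: BrayRPI2001, §6 (81)] -/
theorem nonneg_of_dalembertian_nonpos_twoEnds [ConnectedSpace X]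
    (htwo : ∀ R₁ R₂, IsCompact (e₁.far R₁ ∪ e₂.far R₂)ᶜ) {u : X → ℝ}
    (hu2 : ContMDiff (𝓡 3) 𝓘(ℝ, ℝ) 2 u) (hΔ : ∀ x, (ofRiemannian h).dalembertian u x ≤ 0)
    (hinf₁ : ∀ ε : ℝ, 0 < ε → ∃ R, ∀ x ∈ e₁.far R, -ε < u x)
    (hinf₂ : ∀ ε : ℝ, 0 < ε → ∃ R, ∀ x ∈ e₂.far R, -ε < u x) :
    ∀ x, 0 ≤ u x :=
  nonneg_of_dalembertian_le_twoEnds h htwo hu2 (c := fun _ ↦ 0) continuous_const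
    (fun _ ↦ le_rfl) (fun x ↦ by rw [zero_mul]; exact hΔ x) hinf₁ hinf₂

/-- **Uniqueness on a manifold with exactly two ends**: two `C²` functions with the same
Laplacian whose difference tends to `0` at infinity in both ends coincide (in particular the
harmonic function tending to `1` in one end and to `0` in the other, Bray's (81), is unique).
[cite: LopezGomez2012, Thm. 1.2] [cite: BrayRPI2001, §6 (81)] -/
theorem eq_of_dalembertian_eq_twoEnds [ConnectedSpace X]
    (htwo : ∀ R₁ R₂, IsCompact (e₁.far R₁ ∪ e₂.far R₂)ᶜ) {u v : X → ℝ}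
    (hu2 : ContMDiff (𝓡 3) 𝓘(ℝ, ℝ) 2 u) (hv2 : ContMDiff (𝓡 3) 𝓘(ℝ, ℝ) 2 v)
    (hΔ : ∀ x, (ofRiemannian h).dalembertian u x = (ofRiemannian h).dalembertian v x)
    (hinf₁ : TendstoAtEnd e₁ (u - v) 0) (hinf₂ : TendstoAtEnd e₂ (u - v) 0) :
    u = v := by
  have hsub : ∀ {a b : X → ℝ}, ContMDiff (𝓡 3) 𝓘(ℝ, ℝ) 2 a → ContMDiff (𝓡 3) 𝓘(ℝ, ℝ) 2 b →
      ∀ x, (ofRiemannian h).dalembertian (a - b) x =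
        (ofRiemannian h).dalembertian a x - (ofRiemannian h).dalembertian b x :=
    fun ha hb x ↦ dalembertian_sub (ofRiemannian h) (ha x) (hb x)
  have hflip : ∀ {e : AFEnd X}, TendstoAtEnd e (u - v) 0 → TendstoAtEnd e (v - u) 0 := by
    intro e he
    have key := (tendstoAtEnd_const e 0).sub he
    rw [sub_self] at key
    have : v - u = (fun _ ↦ (0 : ℝ)) - (u - v) := by
      funext x
      simp only [Pi.sub_apply]
      ring
    rw [this]
    exact key
  have hlim : ∀ {e : AFEnd X} {w : X → ℝ}, TendstoAtEnd e w 0 →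
      ∀ ε : ℝ, 0 < ε → ∃ R, ∀ x ∈ e.far R, -ε < w x := by
    intro e w hw ε hε
    obtain ⟨R, -, hR⟩ := hw.exists_radius_lt (show -ε < 0 by linarith)
    exact ⟨R, hR⟩
  have h1 : ∀ x, 0 ≤ (u - v) x :=
    nonneg_of_dalembertian_nonpos_twoEnds h htwo (hu2.sub hv2)
      (fun x ↦ by rw [hsub hu2 hv2 x, hΔ x, sub_self]) (hlim hinf₁) (hlim hinf₂)
  have h2 : ∀ x, 0 ≤ (v - u) x :=
    nonneg_of_dalembertian_nonpos_twoEnds h htwo (hv2.sub hu2)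
      (fun x ↦ by rw [hsub hv2 hu2 x, hΔ x, sub_self]) (hlim (hflip hinf₁)) (hlim (hflip hinf₂))
  funext x
  have a := h1 x
  have b := h2 x
  simp only [Pi.sub_apply] at a b
  linarith

end TwoEnds

/-! ### The potential of a reflection-symmetric two-ended manifold -/

section Symmetry

variable {X : Type} [TopologicalSpace X] [ChartedSpace E3 X] [IsManifold (𝓡 3) ∞ X]
  (D : InitialDataSet (𝓡 3) X) [D.metric.HasLeviCivita] {e₁ e₂ : AFEnd X}

/-- **Bray's (92), the symmetry of the potential.** Let `(X, h)` be connected with exactly the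
two ends `e₁`, `e₂`, and let `ι` be an isometry of `(X, h)` exchanging the ends (`ψ ∘ ι → c` at
`e₂` iff `ψ → c` at `e₁`, and `ψ ∘ ι → c` at `e₁` iff `ψ → c` at `e₂`; e.g. the reflection of a
doubled manifold through its horizon). If `φ` is of class `C²`, `h`-harmonic, `φ → 1` at `e₁`
and `φ → 0` at `e₂` (the potential (81) of the chosen end `e₁`), then `φ + φ ∘ ι = 1`: the
function `1 − φ ∘ ι` is harmonic (`InitialDataSet.dalembertian_comp_isometry`) with the same
limits as `φ`, hence equal to it (`eq_of_dalembertian_eq_twoEnds`). *"It follows from symmetry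
that `φ(x) = ½` on `Σ`, so that `φ(x) = ½(ϕ(x) + 1)`"* (Bray 2001, proof of Thm. 9).
[cite: BrayRPI2001, §6 proof of Thm. 9, (92)] -/
theorem harmonic_add_comp_isometry_eq_one [ConnectedSpace X]
    (htwo : ∀ R₁ R₂, IsCompact (e₁.far R₁ ∪ e₂.far R₂)ᶜ) (ι : Diffeomorph (𝓡 3) (𝓡 3) X X ∞)
    (hiso : ∀ (x : X) (v w : TangentSpace (𝓡 3) x),
      D.h.inner (ι x) (mfderiv (𝓡 3) (𝓡 3) ι x v) (mfderiv (𝓡 3) (𝓡 3) ι x w) = D.h.inner x v w)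
    (h₂₁ : ∀ (ψ : X → ℝ) (c : ℝ), TendstoAtEnd e₂ (ψ ∘ ι) c ↔ TendstoAtEnd e₁ ψ c)
    (h₁₂ : ∀ (ψ : X → ℝ) (c : ℝ), TendstoAtEnd e₁ (ψ ∘ ι) c ↔ TendstoAtEnd e₂ ψ c)
    {φ : X → ℝ} (hφ : ContMDiff (𝓡 3) 𝓘(ℝ, ℝ) 2 φ)
    (hΔ : ∀ x, D.metric.dalembertian φ x = 0) (h1 : TendstoAtEnd e₁ φ 1)
    (h0 : TendstoAtEnd e₂ φ 0) (x : X) : φ x + φ (ι x) = 1 := by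
  haveI : (ofRiemannian D.h).HasLeviCivita := ‹D.metric.HasLeviCivita›
  -- `w = 1 - φ ∘ ι` is `C²`, harmonic, `→ 1` at `e₁` and `→ 0` at `e₂`
  set w : X → ℝ := fun y ↦ (-1) * (φ ∘ ι) y + 1 with hw_def
  have h2 : (2 : ℕ∞ω) ≤ ∞ := WithTop.coe_le_coe.mpr le_top
  have hφι : ContMDiff (𝓡 3) 𝓘(ℝ, ℝ) 2 (φ ∘ ι) := hφ.comp (ι.contMDiff.of_le h2)
  have hw2 : ContMDiff (𝓡 3) 𝓘(ℝ, ℝ) 2 w := (contMDiff_const.mul hφι).add contMDiff_const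
  have hΔw : ∀ y, D.metric.dalembertian w y = 0 := fun y ↦ by
    show (ofRiemannian D.h).dalembertian (fun y ↦ (-1) * (φ ∘ ι) y + 1) y = 0
    rw [dalembertian_affine_apply D.h (-1) 1 (hφι y)]
    show (-1) * D.metric.dalembertian (φ ∘ ι) y = 0
    rw [D.dalembertian_comp_isometry ι hiso (hφ (ι y)), hΔ, mul_zero]
  have hw₁ : TendstoAtEnd e₁ w 1 := by
    have hι0 : TendstoAtEnd e₁ (φ ∘ ι) 0 := (h₁₂ φ 0).2 h0
    have key := (tendstoAtEnd_const e₁ (1 : ℝ)).sub hι0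
    have : w = (fun _ ↦ (1 : ℝ)) - (φ ∘ ι) := by
      funext y; simp only [hw_def, Pi.sub_apply]; ring
    rw [this]
    simpa using key
  have hw₂ : TendstoAtEnd e₂ w 0 := by
    have hι1 : TendstoAtEnd e₂ (φ ∘ ι) 1 := (h₂₁ φ 1).2 h1
    have key := (tendstoAtEnd_const e₂ (1 : ℝ)).sub hι1
    have : w = (fun _ ↦ (1 : ℝ)) - (φ ∘ ι) := by
      funext y; simp only [hw_def, Pi.sub_apply]; ring
    rw [this]
    simpa using key
  -- so `φ = w` by uniqueness
  have hlim₁ : TendstoAtEnd e₁ (φ - w) 0 := by simpa using h1.sub hw₁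
  have hlim₂ : TendstoAtEnd e₂ (φ - w) 0 := by simpa using h0.sub hw₂
  have heq := eq_of_dalembertian_eq_twoEnds D.h (e₁ := e₁) (e₂ := e₂) htwo hφ hw2
    (fun y ↦ by
      show D.metric.dalembertian φ y = D.metric.dalembertian w y
      rw [hΔ, hΔw]) hlim₁ hlim₂
  have hx := congrFun heq x
  simp only [hw_def, Function.comp_apply] at hx
  linarith

/-- **The potential is `½` on the fixed set of the reflection** (in particular on the horizon
`Σ` of a doubled manifold): `ι x = x ⟹ φ x = ½`. [cite: BrayRPI2001, §6 proof of Thm. 9, (92)] -/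
theorem harmonic_eq_half_of_isometry_fixed [ConnectedSpace X]
    (htwo : ∀ R₁ R₂, IsCompact (e₁.far R₁ ∪ e₂.far R₂)ᶜ) (ι : Diffeomorph (𝓡 3) (𝓡 3) X X ∞)
    (hiso : ∀ (x : X) (v w : TangentSpace (𝓡 3) x),
      D.h.inner (ι x) (mfderiv (𝓡 3) (𝓡 3) ι x v) (mfderiv (𝓡 3) (𝓡 3) ι x w) = D.h.inner x v w)
    (h₂₁ : ∀ (ψ : X → ℝ) (c : ℝ), TendstoAtEnd e₂ (ψ ∘ ι) c ↔ TendstoAtEnd e₁ ψ c)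
    (h₁₂ : ∀ (ψ : X → ℝ) (c : ℝ), TendstoAtEnd e₁ (ψ ∘ ι) c ↔ TendstoAtEnd e₂ ψ c)
    {φ : X → ℝ} (hφ : ContMDiff (𝓡 3) 𝓘(ℝ, ℝ) 2 φ)
    (hΔ : ∀ x, D.metric.dalembertian φ x = 0) (h1 : TendstoAtEnd e₁ φ 1)
    (h0 : TendstoAtEnd e₂ φ 0) {x : X} (hx : ι x = x) : φ x = 1 / 2 := by
  have key := harmonic_add_comp_isometry_eq_one D htwo ι hiso h₂₁ h₁₂ hφ hΔ h1 h0 x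
  rw [hx] at key
  linarith

end Symmetry

/-! ### The fixed horizon: its potential `ϕ = 2φ − 1` and its capacity (Bray's (93)) -/

section FixedHorizon

variable {X : Type} [TopologicalSpace X] [ChartedSpace E3 X] [IsManifold (𝓡 3) ∞ X]
  {e₁ : AFEnd X} {V : Opens X}

omit [IsManifold (𝓡 3) ∞ X] in
/-- **The reflected potential, extended by zero, is a test function of the fixed horizon.**
If `V` is an exterior region of `e₁`, `φ` is smooth with `φ → 1` at `e₁` and `φ = ½` on
`∂V` (the fixed horizon, `harmonic_eq_half_of_isometry_fixed`), then
`ϕ = 𝟙_V · (2φ − 1)` — Bray's `ϕ` of (92), `φ = ½(ϕ + 1)` on `M_Σ`, extended by zero inside — is a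
capacity test function of `Σ = ∂V` in the sense of Def. 17 (`IsCapacityTestFn`: continuous
since `2φ − 1 = 0` on `∂V`, smooth on `V`, zero off `V`, `→ 1` at `e₁`).
[cite: BrayRPI2001, §6 proof of Thm. 9, (92)] -/
theorem isCapacityTestFn_indicator_two_mul_sub_one (hV : IsExteriorRegion e₁ V) {φ : X → ℝ}
    (hφ : ContMDiff (𝓡 3) 𝓘(ℝ, ℝ) ∞ φ) (h1 : TendstoAtEnd e₁ φ 1)
    (hhalf : ∀ x ∈ frontier (V : Set X), φ x = 1 / 2) :
    IsCapacityTestFn e₁ V ((V : Set X).indicator fun x ↦ 2 * φ x - 1) := by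
  have hsm : ContMDiff (𝓡 3) 𝓘(ℝ, ℝ) ∞ (fun x ↦ 2 * φ x - 1) :=
    (contMDiff_const.mul hφ).sub contMDiff_const
  refine ⟨?_, ?_, ?_, ?_⟩
  · exact Continuous.indicator (fun x hx ↦ by rw [hhalf x hx]; norm_num) hsm.continuous
  · exact hsm.contMDiffOn.congr fun x hx ↦ indicator_of_mem hx _
  · exact fun x hx ↦ indicator_of_notMem hx _
  · obtain ⟨-, R', -, hfarV, -⟩ := id hV
    rw [e₁.tendstoAtEnd_iff_far] at h1 ⊢
    intro ε hε
    obtain ⟨R₁, hR₁⟩ := h1 (ε / 2) (half_pos hε)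
    refine ⟨max R₁ R', fun x hx ↦ ?_⟩
    have hxV : x ∈ (V : Set X) := hfarV (e₁.far_mono (le_max_right _ _) hx)
    have hx₁ := hR₁ x (e₁.far_mono (le_max_left _ _) hx)
    rw [indicator_of_mem hxV]
    rw [Real.dist_eq] at hx₁ ⊢
    rw [show 2 * φ x - 1 - 1 = 2 * (φ x - 1) by ring, abs_mul, abs_two]
    linarith

omit [ChartedSpace E3 X] [IsManifold (𝓡 3) ∞ X] in
/-- On `V` the extended reflected potential agrees with `2φ − 1` near every point. [folklore] -/
theorem indicator_two_mul_sub_one_eventuallyEq (φ : X → ℝ) {x : X} (hx : x ∈ (V : Set X)) :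
    ((V : Set X).indicator fun y ↦ 2 * φ y - 1) =ᶠ[𝓝 x] fun y ↦ 2 * φ y + (-1) :=
  Filter.eventuallyEq_of_mem (V.isOpen.mem_nhds hx) fun y hy ↦ by
    rw [indicator_of_mem hy]; ring

variable (h : ContMDiffRiemannianMetric (𝓡 3) ∞ E3 (TangentSpace (𝓡 3) : X → Type _))

/-- The extended reflected potential is harmonic on `V` when `φ` is (`Δ(2φ − 1) = 2 Δφ`).
[folklore] -/
theorem dalembertian_indicator_eq_zero [(ofRiemannian h).HasLeviCivita] {φ : X → ℝ}
    (hφ : ContMDiff (𝓡 3) 𝓘(ℝ, ℝ) 2 φ)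
    (hΔ : ∀ x ∈ (V : Set X), (ofRiemannian h).dalembertian φ x = 0) {x : X}
    (hx : x ∈ (V : Set X)) :
    (ofRiemannian h).dalembertian ((V : Set X).indicator fun y ↦ 2 * φ y - 1) x = 0 := by
  rw [(ofRiemannian h).dalembertian_congr_of_eventuallyEq (indicator_two_mul_sub_one_eventuallyEq φ hx),
    dalembertian_affine_apply h 2 (-1) (hφ x), hΔ x hx, mul_zero]

/-- The slope of the extended reflected potential on `V` is `2 |∇φ|`. [folklore] -/
theorem gradNorm_indicator_eq {φ : X → ℝ} (hφ : ContMDiff (𝓡 3) 𝓘(ℝ, ℝ) 1 φ) {x : X}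
    (hx : x ∈ (V : Set X)) :
    gradNorm h ((V : Set X).indicator fun y ↦ 2 * φ y - 1) x = 2 * gradNorm h φ x := by
  have hev : ((V : Set X).indicator fun y ↦ 2 * φ y - 1) =ᶠ[𝓝 x]
      ((fun s : ℝ ↦ 2 * s - 1) ∘ φ) :=
    Filter.eventuallyEq_of_mem (V.isOpen.mem_nhds hx) fun y hy ↦ by
      rw [indicator_of_mem hy]; rfl
  have hG : HasDerivAt (fun s : ℝ ↦ 2 * s - 1) 2 (φ x) := by
    simpa using ((hasDerivAt_id (φ x)).const_mul (2 : ℝ)).sub_const (1 : ℝ)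
  rw [gradNorm_congr_of_eventuallyEq h hev,
    gradNorm_real_comp h hG ((hφ x).mdifferentiableAt one_ne_zero), abs_two]

variable [T2Space X] [LocallyCompactSpace X] [MeasurableSpace X] [BorelSpace X]

/-- The energy of the extended reflected potential over `V` is four times that of `φ`.
[folklore] -/
theorem setLIntegral_gradNorm_sq_indicator_eq {φ : X → ℝ} (hφ : ContMDiff (𝓡 3) 𝓘(ℝ, ℝ) 1 φ) :
    ∫⁻ x in (V : Set X), ENNReal.ofReal
        (gradNorm h ((V : Set X).indicator fun y ↦ 2 * φ y - 1) x ^ 2) ∂riemannianMeasure h =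
      ENNReal.ofReal 4 *
        ∫⁻ x in (V : Set X), ENNReal.ofReal (gradNorm h φ x ^ 2) ∂riemannianMeasure h := by
  rw [← lintegral_const_mul' _ _ ENNReal.ofReal_ne_top]
  refine setLIntegral_congr_fun V.isOpen.measurableSet fun x hx ↦ ?_
  rw [gradNorm_indicator_eq h hφ hx, ← ENNReal.ofReal_mul (by norm_num)]
  congr 1
  ring

omit [IsManifold (𝓡 3) ∞ X] [T2Space X] [LocallyCompactSpace X] [MeasurableSpace X]
  [BorelSpace X] in
/-- **The expansion at infinity doubles**: if `φ ∘ Φ = 1 − c/r + O₁(r⁻²)` in the end `e₁` (in the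
gradient form `‖D(φ ∘ Φ − (1 − c/r))‖ = O(r⁻³)` consumed by `MassCapacityExpansion.lean`), then
the extended reflected potential has `ϕ ∘ Φ = 1 − 2c/r + O₁(r⁻²)` (far out in `V`,
`ϕ = 2φ − 1`). [cite: BrayRPI2001, §6 (82), (87), (92)] -/
theorem isBigO_fderiv_endValue_indicator (hV : IsExteriorRegion e₁ V) {φ : X → ℝ} {c : ℝ}
    (hexp : (fun x : E3 ↦ ‖fderiv ℝ (fun y ↦ endValue e₁ φ y - (1 - c / ‖y‖)) x‖)
      =O[cobounded E3] fun x ↦ ‖x‖ ^ (-3 : ℝ)) :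
    (fun x : E3 ↦ ‖fderiv ℝ (fun y ↦
        endValue e₁ ((V : Set X).indicator fun z ↦ 2 * φ z - 1) y - (1 - 2 * c / ‖y‖)) x‖)
      =O[cobounded E3] fun x ↦ ‖x‖ ^ (-3 : ℝ) := by
  obtain ⟨-, R', -, hfarV, -⟩ := id hV
  set F : E3 → ℝ := fun y ↦ endValue e₁ φ y - (1 - c / ‖y‖) with hF
  set G : E3 → ℝ := fun y ↦
    endValue e₁ ((V : Set X).indicator fun z ↦ 2 * φ z - 1) y - (1 - 2 * c / ‖y‖) with hG
  set S : Set E3 := {y | max R' e₁.R < ‖y‖} with hS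
  have hSo : IsOpen S := isOpen_lt continuous_const continuous_norm
  have hGF : ∀ y ∈ S, G y = ((2 : ℝ) • F) y := by
    intro y hy
    have hyR : e₁.R < ‖y‖ := lt_of_le_of_lt (le_max_right _ _) hy
    have hyR' : R' < ‖y‖ := lt_of_le_of_lt (le_max_left _ _) hy
    have hmem : e₁.dataChart ⟨y, hyR⟩ ∈ (V : Set X) :=
      hfarV (e₁.mem_far_iff.2 ⟨⟨y, hyR⟩, hyR', rfl⟩)
    simp only [hG, hF, Pi.smul_apply, smul_eq_mul, endValue_of_lt e₁ _ hyR,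
      indicator_of_mem hmem]
    ring
  have hderiv : ∀ y ∈ S, fderiv ℝ G y = (2 : ℝ) • fderiv ℝ F y := by
    intro y hy
    have hev : G =ᶠ[𝓝 y] ((2 : ℝ) • F) :=
      Filter.eventuallyEq_of_mem (hSo.mem_nhds hy) hGF
    rw [hev.fderiv_eq, fderiv_const_smul_field]
    rfl
  have hevS : ∀ᶠ y in cobounded E3, y ∈ S := by
    filter_upwards [eventually_cobounded_le_norm (E := E3) (max R' e₁.R + 1)] with y hy
    show max R' e₁.R < ‖y‖
    linarith
  refine (hexp.const_mul_left 2).congr' ?_ EventuallyEq.rfl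
  filter_upwards [hevS] with y hy
  show 2 * ‖fderiv ℝ F y‖ = ‖fderiv ℝ G y‖
  rw [hderiv y hy, norm_smul, Real.norm_eq_abs, abs_two]

variable {h}
variable [SigmaCompactSpace X] (D : InitialDataSet (𝓡 3) X) [D.metric.HasLeviCivita]

/-- **Bray's (93) in terms of the potential: `½ ℰ(Σ, g) = 2 c_φ`.** Let `(X, h)` be connected,
with exactly the two ends `e₁` (asymptotically flat) and `e₂`, carrying an isometry `ι` which
exchanges the ends, and let `V` be an exterior region of `e₁` whose boundary `Σ = ∂V` is fixed
pointwise by `ι` (the doubled manifold `(M̄_Σ, ḡ)` reflected through its horizon, `V = M_Σ ∖ Σ`).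
If `φ` is the smooth `h`-harmonic potential of the chosen end (`φ → 1` at `e₁`, `φ → 0` at `e₂`,
(81)) with finite energy over `V` and expansion `φ ∘ Φ = 1 − c/r + O₁(r⁻²)` at `e₁` ((82):
`ℰ(ḡ) = 2c`), then `φ = ½` on `Σ`, `ϕ = 2φ − 1` (extended by zero) is the capacity potential (86) of
`Σ` with `ϕ ∘ Φ = 1 − 2c/r + O₁(r⁻²)`, and the capacity of Def. 17 is
`ℰ(Σ, h) = horizonCapacity h e₁ V = 2 · (2c) = 4c` (`horizonCapacity_eq_ofReal_of_harmonic_of_expansion'`);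
that is `ℰ(ḡ) = 2c = ½ ℰ(Σ, g)`, Bray's (93). [cite: BrayRPI2001, §6 proof of Thm. 9, (92)–(93)] -/
theorem horizonCapacity_eq_of_harmonic_symmetric [ConnectedSpace X] {e₂ : AFEnd X} {α : ℝ}
    (hα : 0 < α) (hAF : e₁.IsMetricAsymptoticallyFlat D α)
    (htwo : ∀ R₁ R₂, IsCompact (e₁.far R₁ ∪ e₂.far R₂)ᶜ) (ι : Diffeomorph (𝓡 3) (𝓡 3) X X ∞)
    (hiso : ∀ (x : X) (v w : TangentSpace (𝓡 3) x),
      D.h.inner (ι x) (mfderiv (𝓡 3) (𝓡 3) ι x v) (mfderiv (𝓡 3) (𝓡 3) ι x w) = D.h.inner x v w)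
    (h₂₁ : ∀ (ψ : X → ℝ) (c : ℝ), TendstoAtEnd e₂ (ψ ∘ ι) c ↔ TendstoAtEnd e₁ ψ c)
    (h₁₂ : ∀ (ψ : X → ℝ) (c : ℝ), TendstoAtEnd e₁ (ψ ∘ ι) c ↔ TendstoAtEnd e₂ ψ c)
    (hV : IsExteriorRegion e₁ V) (hfix : ∀ x ∈ frontier (V : Set X), ι x = x)
    {φ : X → ℝ} (hφ : ContMDiff (𝓡 3) 𝓘(ℝ, ℝ) ∞ φ)
    (hΔ : ∀ x, D.metric.dalembertian φ x = 0) (h1 : TendstoAtEnd e₁ φ 1)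
    (h0 : TendstoAtEnd e₂ φ 0)
    (hfin : ∫⁻ x in (V : Set X), ENNReal.ofReal (gradNorm D.h φ x ^ 2) ∂riemannianMeasure D.h < ⊤)
    {c : ℝ}
    (hexp : (fun x : E3 ↦ ‖fderiv ℝ (fun y ↦ endValue e₁ φ y - (1 - c / ‖y‖)) x‖)
      =O[cobounded E3] fun x ↦ ‖x‖ ^ (-3 : ℝ)) :
    horizonCapacity D.h e₁ V = ENNReal.ofReal (4 * c) := by
  haveI : (ofRiemannian D.h).HasLeviCivita := ‹D.metric.HasLeviCivita›
  have h2 : (2 : ℕ∞ω) ≤ ∞ := WithTop.coe_le_coe.mpr le_top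
  have h1' : (1 : ℕ∞ω) ≤ ∞ := WithTop.coe_le_coe.mpr le_top
  have hφ2 : ContMDiff (𝓡 3) 𝓘(ℝ, ℝ) 2 φ := hφ.of_le h2
  have hhalf : ∀ x ∈ frontier (V : Set X), φ x = 1 / 2 := fun x hx ↦
    harmonic_eq_half_of_isometry_fixed D htwo ι hiso h₂₁ h₁₂ hφ2 hΔ h1 h0 (hfix x hx)
  have htest := isCapacityTestFn_indicator_two_mul_sub_one hV hφ h1 hhalf
  have hΔV : ∀ x ∈ (V : Set X),
      D.metric.dalembertian ((V : Set X).indicator fun y ↦ 2 * φ y - 1) x = 0 := fun x hx ↦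
    dalembertian_indicator_eq_zero D.h hφ2 (fun y _ ↦ hΔ y) hx
  have hfinV : ∫⁻ x in (V : Set X), ENNReal.ofReal
      (gradNorm D.h ((V : Set X).indicator fun y ↦ 2 * φ y - 1) x ^ 2) ∂riemannianMeasure D.h <
        ⊤ := by
    rw [setLIntegral_gradNorm_sq_indicator_eq D.h (hφ.of_le h1')]
    exact ENNReal.mul_lt_top ENNReal.ofReal_lt_top hfin
  have hexpV := isBigO_fderiv_endValue_indicator hV hexp
  rw [horizonCapacity_eq_ofReal_of_harmonic_of_expansion' D hα hAF hV htest hΔV hfinV hexpV]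
  congr 1
  ring

/-- **`½ ℰ(Σ, g) = 2 c_φ ≥ 0` as real numbers** (the left-hand side of Thm. 9 for the fixed
horizon of a reflection-symmetric two-ended manifold, in terms of the monopole coefficient of
the potential (81) of the chosen end; by (82)/(88) the right-hand side is `ℰ(ḡ) ≤ m̄`).
[cite: BrayRPI2001, §6 proof of Thm. 9, (92)–(93)] -/
theorem horizonCapacity_toReal_div_two_eq_of_harmonic_symmetric [ConnectedSpace X]
    {e₂ : AFEnd X} {α : ℝ} (hα : 0 < α) (hAF : e₁.IsMetricAsymptoticallyFlat D α)
    (htwo : ∀ R₁ R₂, IsCompact (e₁.far R₁ ∪ e₂.far R₂)ᶜ) (ι : Diffeomorph (𝓡 3) (𝓡 3) X X ∞)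
    (hiso : ∀ (x : X) (v w : TangentSpace (𝓡 3) x),
      D.h.inner (ι x) (mfderiv (𝓡 3) (𝓡 3) ι x v) (mfderiv (𝓡 3) (𝓡 3) ι x w) = D.h.inner x v w)
    (h₂₁ : ∀ (ψ : X → ℝ) (c : ℝ), TendstoAtEnd e₂ (ψ ∘ ι) c ↔ TendstoAtEnd e₁ ψ c)
    (h₁₂ : ∀ (ψ : X → ℝ) (c : ℝ), TendstoAtEnd e₁ (ψ ∘ ι) c ↔ TendstoAtEnd e₂ ψ c)
    (hV : IsExteriorRegion e₁ V) (hfix : ∀ x ∈ frontier (V : Set X), ι x = x)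
    {φ : X → ℝ} (hφ : ContMDiff (𝓡 3) 𝓘(ℝ, ℝ) ∞ φ)
    (hΔ : ∀ x, D.metric.dalembertian φ x = 0) (h1 : TendstoAtEnd e₁ φ 1)
    (h0 : TendstoAtEnd e₂ φ 0)
    (hfin : ∫⁻ x in (V : Set X), ENNReal.ofReal (gradNorm D.h φ x ^ 2) ∂riemannianMeasure D.h < ⊤)
    {c : ℝ}
    (hexp : (fun x : E3 ↦ ‖fderiv ℝ (fun y ↦ endValue e₁ φ y - (1 - c / ‖y‖)) x‖)
      =O[cobounded E3] fun x ↦ ‖x‖ ^ (-3 : ℝ)) :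
    (horizonCapacity D.h e₁ V).toReal / 2 = 2 * c ∧ 0 ≤ c := by
  haveI : (ofRiemannian D.h).HasLeviCivita := ‹D.metric.HasLeviCivita›
  have h2 : (2 : ℕ∞ω) ≤ ∞ := WithTop.coe_le_coe.mpr le_top
  have h1' : (1 : ℕ∞ω) ≤ ∞ := WithTop.coe_le_coe.mpr le_top
  have hφ2 : ContMDiff (𝓡 3) 𝓘(ℝ, ℝ) 2 φ := hφ.of_le h2
  have hhalf : ∀ x ∈ frontier (V : Set X), φ x = 1 / 2 := fun x hx ↦
    harmonic_eq_half_of_isometry_fixed D htwo ι hiso h₂₁ h₁₂ hφ2 hΔ h1 h0 (hfix x hx)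
  have htest := isCapacityTestFn_indicator_two_mul_sub_one hV hφ h1 hhalf
  have hΔV : ∀ x ∈ (V : Set X),
      D.metric.dalembertian ((V : Set X).indicator fun y ↦ 2 * φ y - 1) x = 0 := fun x hx ↦
    dalembertian_indicator_eq_zero D.h hφ2 (fun y _ ↦ hΔ y) hx
  have hfinV : ∫⁻ x in (V : Set X), ENNReal.ofReal
      (gradNorm D.h ((V : Set X).indicator fun y ↦ 2 * φ y - 1) x ^ 2) ∂riemannianMeasure D.h <
        ⊤ := by
    rw [setLIntegral_gradNorm_sq_indicator_eq D.h (hφ.of_le h1')]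
    exact ENNReal.mul_lt_top ENNReal.ofReal_lt_top hfin
  have hexpV := isBigO_fderiv_endValue_indicator hV hexp
  obtain ⟨hc, hc0⟩ :=
    horizonCapacity_toReal_div_two_eq_of_harmonic_of_expansion' D hα hAF hV htest hΔV hfinV hexpV
  exact ⟨hc, by linarith⟩

end FixedHorizon

end Literature.Geometry.Lorentzian

end
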